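import Summits.QuantumFields.YangMills.Theorems.BalabanUVNodesN22WindowSoftTwoPointAtSlots
import Summits.QuantumFields.YangMills.Theorems.BalabanUVNodesD4KernelDecayOfWindowed

/-!
# NODE N22 (NE9) — THE SOFT ROAD AT W1's ACTIVITY LEVEL, AT THE RECORD: W1-19b's letters OF RECORD `WindowedNE9OfRecord₁₃` ∕ `WindowedDecayOfRecord₁₃`
# under W1-20's law `Localizes17OfRecord₁₃`, and K3⁷ v5 §2b's raw inputs `h9` (kernel-currency NE9 of the functional of record) ∕ `hdec`
# (`KernelDecayOfRecord₁₃`) from activity-level slots + the displayed (1.21) existence `PolLimitsExistOfRecord₁₃`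

Cell `pub-ymgap`, Track A (HUMAN RULING D-0062), WIDTH SEAT `dag-n22-w2` (g3) on node n22 = NE9; `--kind proof --supports stmt-QuantumFields-20544 --as helper`
(K3⁷ `SpineGivenEndpointR13SepCoPH`), COUNT-NEUTRAL; THEOREMS ONLY (0 `def`, 0 `sorry`, standard axioms).  Sequel of `…N22WindowSoftTwoPointAtSlots` (this seat, g3):
there the two W1-19b letters were obtained at a GENERIC W1 reading `localizedSum F S emb` from activity-level hypotheses; here they are carried to the OBJECTS OF
RECORD and to the exact hypothesis shapes K3⁷ v5 (941dddb108cbaacf) §2b reads.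

WHAT.  §1 ★★★ `windowedNE9OfRecord₁₃_of_activitySlots` ∕ `windowedDecayOfRecord₁₃_of_activitySlots`: for towers `S K : ClusterTower (F.P K) (MatA N) M` and reading maps
`emb : ReadingMaps F (MatA N) (MatA N)` satisfying W1-20's DISPLAYED law at the record `Localizes17OfRecord₁₃ F N θ S emb` (the merged term family of record IS the
localized sum from `K ≥ k+1` on), the activity-level hypotheses of `…AtSlots` at the record's β-chart (`ρ := θ.ρ8`, `bV := θ.bV`, window `]0, θ.γ]^ℕ`) give
`WindowedNE9OfRecord₁₃ F N θ δ₁ (C_9·Λ)` and `WindowedDecayOfRecord₁₃ F N θ μ ν δ₁` (W1-19b `…_iff_of_localizes`, p595370).  §2 ★★★ THE K3⁷ §2b FACES: for a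
letter block `ℓ` (signs `ℓ.Signs`) DOMINATING the engine's constants — `ℓ.κ ≤ δ₁`, `C_9·Λ k i ≤ ℓ.moduli k i` (the letters are monotone, `…AtSlots` §1b; e.g. geometric
young-Lipschitz moduli `Λ (k+1) i = c₉ω^{k+1−i}` with `C_9 c₉ ≤ ℓ.C₉`, `ω ≤ ℓ.ω`) — `ne9_EA_objectsOfRecord₁₃_of_activitySlots : NE9 ((objectsOfRecord₁₃ F N θ ℓ).EA 0) (Window θ.γ)
ℓ.κ ℓ.moduli` — LITERALLY the `h9` of `n22At_rrOfRecord_of_pinned` — from the slots + `PolLimitsExistOfRecord₁₃ F N θ` (the (1.21) passage is dag-n22-w3's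
`n22At_u3OfRecord₁₃_objectsOfRecord₁₃_of_windowed`, p593053), and `kernelDecayOfRecord₁₃_of_activitySlots : KernelDecayOfRecord₁₃ F N θ μ ν κ′` at any `κ′ ≤ δ₁` — the
`hdec` of `readOutAt_rrOfRecord_of_pinned` at `(μ, ν) = (0, 1)`, `κ′ := ℓ.κ` — from `Bound238` + activity holomorphy + tails + `PolLimitsExistOfRecord₁₃` (dag-n22-w3's
`kernelDecayOfRecord₁₃_of_windowed`, p595227).  §3 ★★★ `n22At_rateCarriers_of_kernels_pin_of_activitySlots`: the PIN FACE — K3⁷ v5's N22 conjunct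
`N22At (rateCarriersOfRecord₁₃CoPH 𝔯 F θ hP g₀ os k).u3` for EVERY `k` at a reading pinned to the kernel objects of record (`U3PinnedKernels` read at the tuple), from §2.
So a prover of STUB 1 at a pinned reading owes, for the N22 conjunct and (D4)'s decay clause, EXACTLY: the towers∕reading with `Localizes17OfRecord₁₃`, W1's two activity
slots on the admissible spaces with Road 1's numerals, the complexified minimizer readings with holomorphic activities and exponentially localized site weights,
`PolLimitsExistOfRecord₁₃`, and a letter block dominating the engine's constants (dag-n22-w3 g3's RIDER (ii), pub-ymgap INBOX l.28776, adopted).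

HONEST FRAMING (binding).  Count-neutral COMPOSITION of landed theorems; NO estimate of Bałaban's is proved or asserted.  DISPLAYED (hypotheses), with owners:
`Localizes17OfRecord₁₃` (the cluster expansion's content — NODE A ∕ N10), `Bound238`∕`YoungLipschitz` at the towers of record (N10 ∕ NODE A; differenced slot NOT PRINTED),
activity holomorphy + the complexified minimizer reading `Φ` and its tails (NODE A ∕ N09; [I] p. 264, p. 282, [II] p. 15), `PolLimitsExistOfRecord₁₃` ([I] (1.21) p. 264;
dag-n22-w3's p595960∕p597055 road), numerals, the letter domination rows.  Nothing of the record is constructed or claimed to meet them; N22 is NOT discharged (typed 28∕28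
· discharged 5∕27 UNCHANGED); K3⁷ OPEN and NOT claimed; NE9 NOT IN PRINT for d = 4; no count claim (the chair's single count line is the only count); one finite 𝕋⁴
programme at fixed ε — R4 closes the CONDITIONAL rung `BalabanLadder.UV` only; NOTHING about the continuum limit, ℝ⁴, infinite volume, OS axioms, a mass gap or the
Clay problem is proved or claimed by any of this.  References (TYPES only): [I] = Bałaban, CMP 109 (1987) (1.7) p. 261, (1.18) p. 263, (1.20)–(1.21) p. 264, p. 282,
(5.10) p. 293; [II] = CMP 116 (1988) (2.13)–(2.14) pp. 14–15, (2.38) p. 20, (2.39)–(2.41) p. 21.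
-/

noncomputable section

open Filter Topology Metric Set
open scoped BigOperators

namespace YMDAG.N22.WindowSoftTwoPoint

open Literature.MathematicalPhysics.QuantumFieldTheory.Balaban1983to89
open Literature.MathematicalPhysics.QuantumFieldTheory.Balaban1983to89.T4Continuum (T4Family ULoop)
open Literature.MathematicalPhysics.QuantumFieldTheory.Balaban1983to89.T4OutputRate (Window NE9)
open Literature.MathematicalPhysics.QuantumFieldTheory.Balaban1983to89.Node00 (polWindow siteOfInt Stage13Params Stage13HParams U3Letters₁₁ MatA)
open Literature.MathematicalPhysics.QuantumFieldTheory.Balaban1983to89.Node00.Sect2 (domCount domSys CPair)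
open Literature.MathematicalPhysics.QuantumFieldTheory.Balaban1983to89.Node00.LocalizedSum17 (localizedSum ReadingMaps Localizes17OfRecord₁₃)
open Literature.MathematicalPhysics.QuantumFieldTheory.Balaban1983to89.Node00.W1 (ClusterTower ClusterStep)
open Literature.MathematicalPhysics.QuantumFieldTheory.Balaban1983to89.Node00.U3OfKernels (histPrefix objectsOfRecord₁₃ KernelDecayOfRecord₁₃)
open Literature.MathematicalPhysics.QuantumFieldTheory.Balaban1983to89.Node00.U3KernelLetters (WindowedNE9OfRecord₁₃ WindowedDecayOfRecord₁₃ PolLimitsExistOfRecord₁₃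
  windowedNE9OfRecord₁₃_iff windowedDecayOfRecord₁₃_iff polLimitsExistOfRecord₁₃_iff windowedNE9OfRecord₁₃_iff_of_localizes windowedDecayOfRecord₁₃_iff_of_localizes)
open Literature.MathematicalPhysics.QuantumFieldTheory.Balaban1983to89.B12Decay510 (delta1)
open Literature.MathematicalPhysics.QuantumFieldTheory.Balaban1983to89.B12Decay510Window (K₁)
open Literature.MathematicalPhysics.QuantumFieldTheory.Balaban1983to89.B12Decay510Torus (distCT nearT)
open Literature.MathematicalPhysics.QuantumFieldTheory.Balaban1983to89.B12TreeDecay (K₀ kappa₀)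
open Literature.MathematicalPhysics.QuantumFieldTheory.Balaban1983to89.TreeLengthTorus (TPt)
open Literature.MathematicalPhysics.QuantumFieldTheory.Balaban1983to89.B12Sec2to5 (l1)
open YMDAG.UVSplit (N22At u3OfRecord₁₃ RateReading₁₃CoPH rateCarriersOfRecord₁₃CoPH)
open YMDAG.N22.AtKernels (n22At_u3OfRecord₁₃_objectsOfRecord₁₃_iff n22At_u3OfRecord₁₃_objectsOfRecord₁₃_of_windowed kernelDecayOfRecord₁₃_of_windowed
  n22At_rateCarriers_of_kernels_pin_of_ne9)

open scoped Matrix.Norms.L2Operator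

variable (F : T4Family) (N : ℕ) [NeZero N]

/-! ## §1 The letters OF RECORD under W1-20's law `Localizes17OfRecord₁₃` -/

open Classical in
/-- ★★★ **WINDOWED NE9 OF RECORD FROM ACTIVITY-LEVEL SLOTS OF A LOCALIZING W1 READING.**  Towers `S K : ClusterTower (F.P K) (MatA N) M` (`M = L^{m′}`) and reading maps
`emb` satisfying W1-20's displayed law at the record `Localizes17OfRecord₁₃ F N θ S emb`; at every tower and level W1's `Bound238` and `YoungLipschitz` (moduli `Λ (k+1) ·`) on
prefix sets containing the cut histories of the window `]0, θ.γ]^ℕ`, Road 1's numerals ONCE; complexified probe readings `Φ K k X` of the record's β-chart (`Φ (ι B) =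
emb K k (exp θ.ρ8 B)`) on open `U K k X ⊇ ball 0 r` mapping into the spaces with holomorphic activities; site weights `‖ι K k X e_{l,t,c}‖ ≤ w K k X t` (basis `θ.bV`) with
the minimizer tails `w K k X t ≤ B₃e^{−δ₀ distCT(cast t, X)}` ⟹ `WindowedNE9OfRecord₁₃ F N θ δ₁ (C_9·Λ)`, `δ₁ = ½min{δ₀, κ(4M)⁻¹}`,
`C_9 = (16·8e·9·64·K₀(64,8)²·B₃²∕r²)·e^{12Mδ₁}K₀(64,8)K₁(4,δ₀∕2)` (`…AtSlots` at the chart of record + W1-19b `windowedNE9OfRecord₁₃_iff_of_localizes`). -/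
theorem windowedNE9OfRecord₁₃_of_activitySlots (θ : Stage13Params F N) (m' : ℕ) (M : ℕ) [NeZero M] (hM : M = F.L ^ m')
    (S : (K : ℕ) → ClusterTower (F.P K) (MatA N) M) (emb : ReadingMaps F (MatA N) (MatA N)) (hloc : Localizes17OfRecord₁₃ F N θ S emb)
    (Wk : (K k : ℕ) → Set (Fin (k + 1) → ℝ)) (hWk : ∀ g ∈ Window θ.γ, ∀ K k, histPrefix g k ∈ Wk K k)
    (sp : (K k : ℕ) → (domSys (F.P K) M (k + 1)).Dom → Set (CPair (F.P K) (MatA N)))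
    {A R r₁ κ δ₀ B₃ r : ℝ} (Λ : ℕ → ℕ → ℝ)
    (hA : 0 < A) (hr₁ : 0 ≤ r₁) (hκ : κ ≤ r₁) (hκ₀ : kappa₀ (4 * 2 ^ 4) (2 * 4) ≤ κ / 2) (hrate : r₁ + 2 * (64 * Real.log 162) + 2 ≤ R)
    (hsmall : 2 * A * Real.exp (5 * r₁ + 1) * K₀ 64 8 * 9 * 64 ≤ 1) (hΛ : ∀ k i, 0 ≤ Λ k i) (hδ₀ : 0 < δ₀) (hB₃ : 0 ≤ B₃) (hr : 0 < r)
    (h238 : ∀ K k, ((S K) k).Bound238 (Wk K k) (sp K k) A R)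
    (hYL : ∀ K k, ((S K) k).YoungLipschitz (Wk K k) (sp K k) (fun i : Fin (k + 1) => Λ (k + 1) i) R)
    (Ec : ℕ → ℕ → Type*) [∀ K k, NormedAddCommGroup (Ec K k)] [∀ K k, NormedSpace ℂ (Ec K k)]
    (ι : letI := θ.instVβ₁; letI := θ.instVβ₂
      (K k : ℕ) → (domSys (F.P K) M (k + 1)).Dom → ((Fin (F.P K).d → Site (F.P K) (k + 1) → θ.Vβ) →L[ℝ] Ec K k))
    (Φ : (K k : ℕ) → (domSys (F.P K) M (k + 1)).Dom → Ec K k → CPair (F.P K) (MatA N))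
    (U : (K k : ℕ) → (domSys (F.P K) M (k + 1)).Dom → Set (Ec K k)) (hU : ∀ K k X, IsOpen (U K k X)) (hrU : ∀ K k X, ball (0 : Ec K k) r ⊆ U K k X)
    (hHhol : ∀ g ∈ Window θ.γ, ∀ (K k : ℕ) (X Z : (domSys (F.P K) M (k + 1)).Dom), Z.1 ⊆ X.1 →
      DifferentiableOn ℂ (fun z => ((S K) k).H (histPrefix g k) (Φ K k X z) Z) (U K k X))
    (hΦemb : letI := θ.instVβ₁; letI := θ.instVβ₂
      ∀ (K k : ℕ) (X : (domSys (F.P K) M (k + 1)).Dom) (B : Fin (F.P K).d → Site (F.P K) (k + 1) → θ.Vβ),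
        Φ K k X (ι K k X B) = emb K k (fun l t => NormedSpace.exp (θ.ρ8 (B l t))))
    (hΦsp : ∀ (K k : ℕ) (X : (domSys (F.P K) M (k + 1)).Dom), ∀ z ∈ U K k X, ∀ Z : (domSys (F.P K) M (k + 1)).Dom, Z.1 ⊆ X.1 → Φ K k X z ∈ sp K k Z)
    (w : (K k : ℕ) → (domSys (F.P K) M (k + 1)).Dom → Site (F.P K) (k + 1) → ℝ) (hw₀ : ∀ K k X t, 0 ≤ w K k X t)
    (hw : letI := θ.instVβ₁; letI := θ.instVβ₂; letI := θ.instιβ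
      ∀ (K k : ℕ) (X : (domSys (F.P K) M (k + 1)).Dom) (l : Fin (F.P K).d) (t : Site (F.P K) (k + 1)) (c : θ.ιβ),
        ‖ι K k X (Pi.single l (Pi.single t (θ.bV c)))‖ ≤ w K k X t)
    (htail : ∀ (K k : ℕ) (X : (domSys (F.P K) M (k + 1)).Dom) (t : Site (F.P K) (k + 1)),
      let e : Site (F.P K) (k + 1) → TPt 4 (domCount (F.P K) M (k + 1) * M) := fun x i => (ZMod.cast (x i) : ZMod (domCount (F.P K) M (k + 1) * M))
      w K k X t ≤ B₃ * Real.exp (-δ₀ * distCT (domCount (F.P K) M (k + 1)) M (e t) (nearT (M := M) (e t) X))) :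
    WindowedNE9OfRecord₁₃ F N θ (delta1 δ₀ κ ((M : ℝ) * 4))
      (fun k i => (16 * (8 * (Real.exp 1 * 9 * 64 * K₀ 64 8 ^ 2)) * B₃ ^ 2 / r ^ 2) *
        Real.exp (delta1 δ₀ κ ((M : ℝ) * 4) * ((M : ℝ) * 4) * 3) * K₀ (4 * 2 ^ 4) (2 * 4) * K₁ 4 (δ₀ / 2) * Λ k i) := by
  letI := θ.instVβ₁; letI := θ.instVβ₂; letI := θ.instιβ
  exact (windowedNE9OfRecord₁₃_iff_of_localizes F N θ S emb hloc _ _).2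
    (windowedNE9_localizedSum_of_activitySlots F m' M hM S emb θ.ρ8 θ.bV (Window θ.γ) Wk hWk sp Λ hA hr₁ hκ hκ₀ hrate hsmall hΛ hδ₀ hB₃ hr
      h238 hYL Ec ι Φ U hU hrU hHhol hΦemb hΦsp w hw₀ hw htail)

open Classical in
/-- ★★★ **WINDOWED (5.10) DECAY OF RECORD FROM ACTIVITY-LEVEL SLOTS OF A LOCALIZING W1 READING** (value letter): towers∕reading with `Localizes17OfRecord₁₃ F N θ S emb`,
`Bound238` at every tower and level (`0 ≤ A`, single smallness), complexified readings of the record's β-chart with holomorphic activities at the cut histories of the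
window, site weights with the minimizer tails ⟹ `WindowedDecayOfRecord₁₃ F N θ μ ν δ₁` (`…AtSlots` + W1-19b `windowedDecayOfRecord₁₃_iff_of_localizes`). -/
theorem windowedDecayOfRecord₁₃_of_activitySlots (θ : Stage13Params F N) (m' : ℕ) (M : ℕ) [NeZero M] (hM : M = F.L ^ m')
    (S : (K : ℕ) → ClusterTower (F.P K) (MatA N) M) (emb : ReadingMaps F (MatA N) (MatA N)) (hloc : Localizes17OfRecord₁₃ F N θ S emb)
    (Wk : (K k : ℕ) → Set (Fin (k + 1) → ℝ)) (hWk : ∀ g ∈ Window θ.γ, ∀ K k, histPrefix g k ∈ Wk K k)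
    (sp : (K k : ℕ) → (domSys (F.P K) M (k + 1)).Dom → Set (CPair (F.P K) (MatA N)))
    {A R r₁ κ δ₀ B₃ r : ℝ}
    (hA : 0 ≤ A) (hr₁ : 0 ≤ r₁) (hκ : κ ≤ r₁) (hκ₀ : kappa₀ (4 * 2 ^ 4) (2 * 4) ≤ κ / 2) (hrate : r₁ + 2 * (64 * Real.log 162) + 2 ≤ R)
    (hsmall : A * Real.exp (5 * r₁ + 1) * K₀ 64 8 * 9 * 64 ≤ 1) (hδ₀ : 0 < δ₀) (hB₃ : 0 ≤ B₃) (hr : 0 < r)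
    (h238 : ∀ K k, ((S K) k).Bound238 (Wk K k) (sp K k) A R)
    (Ec : ℕ → ℕ → Type*) [∀ K k, NormedAddCommGroup (Ec K k)] [∀ K k, NormedSpace ℂ (Ec K k)]
    (ι : letI := θ.instVβ₁; letI := θ.instVβ₂
      (K k : ℕ) → (domSys (F.P K) M (k + 1)).Dom → ((Fin (F.P K).d → Site (F.P K) (k + 1) → θ.Vβ) →L[ℝ] Ec K k))
    (Φ : (K k : ℕ) → (domSys (F.P K) M (k + 1)).Dom → Ec K k → CPair (F.P K) (MatA N))
    (U : (K k : ℕ) → (domSys (F.P K) M (k + 1)).Dom → Set (Ec K k)) (hU : ∀ K k X, IsOpen (U K k X)) (hrU : ∀ K k X, ball (0 : Ec K k) r ⊆ U K k X)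
    (hHhol : ∀ g ∈ Window θ.γ, ∀ (K k : ℕ) (X Z : (domSys (F.P K) M (k + 1)).Dom), Z.1 ⊆ X.1 →
      DifferentiableOn ℂ (fun z => ((S K) k).H (histPrefix g k) (Φ K k X z) Z) (U K k X))
    (hΦemb : letI := θ.instVβ₁; letI := θ.instVβ₂
      ∀ (K k : ℕ) (X : (domSys (F.P K) M (k + 1)).Dom) (B : Fin (F.P K).d → Site (F.P K) (k + 1) → θ.Vβ),
        Φ K k X (ι K k X B) = emb K k (fun l t => NormedSpace.exp (θ.ρ8 (B l t))))
    (hΦsp : ∀ (K k : ℕ) (X : (domSys (F.P K) M (k + 1)).Dom), ∀ z ∈ U K k X, ∀ Z : (domSys (F.P K) M (k + 1)).Dom, Z.1 ⊆ X.1 → Φ K k X z ∈ sp K k Z)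
    (w : (K k : ℕ) → (domSys (F.P K) M (k + 1)).Dom → Site (F.P K) (k + 1) → ℝ) (hw₀ : ∀ K k X t, 0 ≤ w K k X t)
    (hw : letI := θ.instVβ₁; letI := θ.instVβ₂; letI := θ.instιβ
      ∀ (K k : ℕ) (X : (domSys (F.P K) M (k + 1)).Dom) (l : Fin (F.P K).d) (t : Site (F.P K) (k + 1)) (c : θ.ιβ),
        ‖ι K k X (Pi.single l (Pi.single t (θ.bV c)))‖ ≤ w K k X t)
    (htail : ∀ (K k : ℕ) (X : (domSys (F.P K) M (k + 1)).Dom) (t : Site (F.P K) (k + 1)),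
      let e : Site (F.P K) (k + 1) → TPt 4 (domCount (F.P K) M (k + 1) * M) := fun x i => (ZMod.cast (x i) : ZMod (domCount (F.P K) M (k + 1) * M))
      w K k X t ≤ B₃ * Real.exp (-δ₀ * distCT (domCount (F.P K) M (k + 1)) M (e t) (nearT (M := M) (e t) X)))
    (μ ν : Fin 4) :
    WindowedDecayOfRecord₁₃ F N θ μ ν (delta1 δ₀ κ ((M : ℝ) * 4)) := by
  letI := θ.instVβ₁; letI := θ.instVβ₂; letI := θ.instιβ
  exact (windowedDecayOfRecord₁₃_iff_of_localizes F N θ S emb hloc μ ν _).2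
    (windowedDecay_localizedSum_of_activitySlots F m' M hM S emb θ.ρ8 θ.bV (Window θ.γ) Wk hWk sp hA hr₁ hκ hκ₀ hrate hsmall hδ₀ hB₃ hr
      h238 Ec ι Φ U hU hrU hHhol hΦemb hΦsp w hw₀ hw htail μ ν)

/-! ## §2 K3⁷ v5 §2b's raw inputs at the pinned objects: `h9` (NE9 of the functional of record) and `hdec` (`KernelDecayOfRecord₁₃`) -/

open Classical in
/-- ★★★ **THE `h9` OF K3⁷ v5 §2b `n22At_rrOfRecord_of_pinned` FROM ACTIVITY-LEVEL SLOTS + THE (1.21) EXISTENCE OF RECORD.**  For a letter block `ℓ` with its signs which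
DOMINATES the engine's constants — `ℓ.κ ≤ δ₁` and `C_9·Λ k i ≤ ℓ.moduli k i` (e.g. `Λ (k+1) i = c₉ω^{k+1−i}` with `C_9 c₉ ≤ ℓ.C₉`, `ω ≤ ℓ.ω`) — the towers∕reading with
`Localizes17OfRecord₁₃ F N θ S emb`, the activity-level hypotheses of §1 and the displayed (1.21) existence `PolLimitsExistOfRecord₁₃ F N θ` give kernel-currency NE9 of the
run-A functional OF RECORD on the window with the letters' rate and moduli: `NE9 ((objectsOfRecord₁₃ F N θ ℓ).EA 0) (Window θ.γ) ℓ.κ ℓ.moduli` — §1's letter weakened by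
`windowedNE9_of_le`, then dag-n22-w3's (1.21) passage `n22At_u3OfRecord₁₃_objectsOfRecord₁₃_of_windowed` + `…_iff` (p593053). -/
theorem ne9_EA_objectsOfRecord₁₃_of_activitySlots (θ : Stage13Params F N) (ℓ : U3Letters₁₁) (hs : ℓ.Signs) (hlim : PolLimitsExistOfRecord₁₃ F N θ)
    (m' : ℕ) (M : ℕ) [NeZero M] (hM : M = F.L ^ m')
    (S : (K : ℕ) → ClusterTower (F.P K) (MatA N) M) (emb : ReadingMaps F (MatA N) (MatA N)) (hloc : Localizes17OfRecord₁₃ F N θ S emb)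
    (Wk : (K k : ℕ) → Set (Fin (k + 1) → ℝ)) (hWk : ∀ g ∈ Window θ.γ, ∀ K k, histPrefix g k ∈ Wk K k)
    (sp : (K k : ℕ) → (domSys (F.P K) M (k + 1)).Dom → Set (CPair (F.P K) (MatA N)))
    {A R r₁ κ δ₀ B₃ r : ℝ} (Λ : ℕ → ℕ → ℝ)
    (hA : 0 < A) (hr₁ : 0 ≤ r₁) (hκ : κ ≤ r₁) (hκ₀ : kappa₀ (4 * 2 ^ 4) (2 * 4) ≤ κ / 2) (hrate : r₁ + 2 * (64 * Real.log 162) + 2 ≤ R)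
    (hsmall : 2 * A * Real.exp (5 * r₁ + 1) * K₀ 64 8 * 9 * 64 ≤ 1) (hΛ : ∀ k i, 0 ≤ Λ k i) (hδ₀ : 0 < δ₀) (hB₃ : 0 ≤ B₃) (hr : 0 < r)
    (h238 : ∀ K k, ((S K) k).Bound238 (Wk K k) (sp K k) A R)
    (hYL : ∀ K k, ((S K) k).YoungLipschitz (Wk K k) (sp K k) (fun i : Fin (k + 1) => Λ (k + 1) i) R)
    (Ec : ℕ → ℕ → Type*) [∀ K k, NormedAddCommGroup (Ec K k)] [∀ K k, NormedSpace ℂ (Ec K k)]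
    (ι : letI := θ.instVβ₁; letI := θ.instVβ₂
      (K k : ℕ) → (domSys (F.P K) M (k + 1)).Dom → ((Fin (F.P K).d → Site (F.P K) (k + 1) → θ.Vβ) →L[ℝ] Ec K k))
    (Φ : (K k : ℕ) → (domSys (F.P K) M (k + 1)).Dom → Ec K k → CPair (F.P K) (MatA N))
    (U : (K k : ℕ) → (domSys (F.P K) M (k + 1)).Dom → Set (Ec K k)) (hU : ∀ K k X, IsOpen (U K k X)) (hrU : ∀ K k X, ball (0 : Ec K k) r ⊆ U K k X)
    (hHhol : ∀ g ∈ Window θ.γ, ∀ (K k : ℕ) (X Z : (domSys (F.P K) M (k + 1)).Dom), Z.1 ⊆ X.1 →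
      DifferentiableOn ℂ (fun z => ((S K) k).H (histPrefix g k) (Φ K k X z) Z) (U K k X))
    (hΦemb : letI := θ.instVβ₁; letI := θ.instVβ₂
      ∀ (K k : ℕ) (X : (domSys (F.P K) M (k + 1)).Dom) (B : Fin (F.P K).d → Site (F.P K) (k + 1) → θ.Vβ),
        Φ K k X (ι K k X B) = emb K k (fun l t => NormedSpace.exp (θ.ρ8 (B l t))))
    (hΦsp : ∀ (K k : ℕ) (X : (domSys (F.P K) M (k + 1)).Dom), ∀ z ∈ U K k X, ∀ Z : (domSys (F.P K) M (k + 1)).Dom, Z.1 ⊆ X.1 → Φ K k X z ∈ sp K k Z)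
    (w : (K k : ℕ) → (domSys (F.P K) M (k + 1)).Dom → Site (F.P K) (k + 1) → ℝ) (hw₀ : ∀ K k X t, 0 ≤ w K k X t)
    (hw : letI := θ.instVβ₁; letI := θ.instVβ₂; letI := θ.instιβ
      ∀ (K k : ℕ) (X : (domSys (F.P K) M (k + 1)).Dom) (l : Fin (F.P K).d) (t : Site (F.P K) (k + 1)) (c : θ.ιβ),
        ‖ι K k X (Pi.single l (Pi.single t (θ.bV c)))‖ ≤ w K k X t)
    (htail : ∀ (K k : ℕ) (X : (domSys (F.P K) M (k + 1)).Dom) (t : Site (F.P K) (k + 1)),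
      let e : Site (F.P K) (k + 1) → TPt 4 (domCount (F.P K) M (k + 1) * M) := fun x i => (ZMod.cast (x i) : ZMod (domCount (F.P K) M (k + 1) * M))
      w K k X t ≤ B₃ * Real.exp (-δ₀ * distCT (domCount (F.P K) M (k + 1)) M (e t) (nearT (M := M) (e t) X)))
    (hℓκ : ℓ.κ ≤ delta1 δ₀ κ ((M : ℝ) * 4))
    (hdom : ∀ k i, (16 * (8 * (Real.exp 1 * 9 * 64 * K₀ 64 8 ^ 2)) * B₃ ^ 2 / r ^ 2) *
        Real.exp (delta1 δ₀ κ ((M : ℝ) * 4) * ((M : ℝ) * 4) * 3) * K₀ (4 * 2 ^ 4) (2 * 4) * K₁ 4 (δ₀ / 2) * Λ k i ≤ ℓ.moduli k i) :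
    NE9 ((objectsOfRecord₁₃ F N θ ℓ).EA 0) (Window θ.γ) ℓ.κ ℓ.moduli := by
  have h9 := windowedNE9OfRecord₁₃_of_activitySlots F N θ m' M hM S emb hloc Wk hWk sp Λ hA hr₁ hκ hκ₀ hrate hsmall hΛ hδ₀ hB₃ hr h238 hYL
    Ec ι Φ U hU hrU hHhol hΦemb hΦsp w hw₀ hw htail
  have hmod : ∀ k i, 0 ≤ ℓ.moduli k i := fun k i => by
    rw [U3Letters₁₁.moduli_apply]; exact mul_nonneg hs.C₉_nonneg (pow_nonneg hs.ω_nonneg _)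
  have h9' : WindowedNE9OfRecord₁₃ F N θ ℓ.κ ℓ.moduli := by
    letI := θ.instVβ₁; letI := θ.instVβ₂; letI := θ.instιβ
    exact windowedNE9_of_le F _ θ.ρ8 θ.bV h9 hℓκ hdom hmod
  rw [← n22At_u3OfRecord₁₃_objectsOfRecord₁₃_iff F N θ ℓ hs 0]
  exact n22At_u3OfRecord₁₃_objectsOfRecord₁₃_of_windowed F N θ ℓ hs 0 ((polLimitsExistOfRecord₁₃_iff F N θ).1 hlim)
    ((windowedNE9OfRecord₁₃_iff F N θ _ _).1 h9')

open Classical in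
/-- ★★★ **THE (5.10) CLAUSE OF RECORD `KernelDecayOfRecord₁₃ F N θ μ ν κ′` FROM ACTIVITY-LEVEL SLOTS + THE (1.21) EXISTENCE OF RECORD, AT ANY RATE `κ′ ≤ δ₁`** ((D4)'s decay
input at the pinned objects; K3⁷ v5 §2b `readOutAt_rrOfRecord_of_pinned` reads it at `(μ, ν) = (0, 1)`, `κ′ := ℓ.κ`): §1's value letter weakened by `windowedDecay_of_le` +
`PolLimitsExistOfRecord₁₃ F N θ` + dag-n22-w3's passage `kernelDecayOfRecord₁₃_of_windowed` (p595227). -/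
theorem kernelDecayOfRecord₁₃_of_activitySlots (θ : Stage13Params F N) (hlim : PolLimitsExistOfRecord₁₃ F N θ) (m' : ℕ) (M : ℕ) [NeZero M] (hM : M = F.L ^ m')
    (S : (K : ℕ) → ClusterTower (F.P K) (MatA N) M) (emb : ReadingMaps F (MatA N) (MatA N)) (hloc : Localizes17OfRecord₁₃ F N θ S emb)
    (Wk : (K k : ℕ) → Set (Fin (k + 1) → ℝ)) (hWk : ∀ g ∈ Window θ.γ, ∀ K k, histPrefix g k ∈ Wk K k)
    (sp : (K k : ℕ) → (domSys (F.P K) M (k + 1)).Dom → Set (CPair (F.P K) (MatA N)))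
    {A R r₁ κ δ₀ B₃ r κ' : ℝ}
    (hA : 0 ≤ A) (hr₁ : 0 ≤ r₁) (hκ : κ ≤ r₁) (hκ₀ : kappa₀ (4 * 2 ^ 4) (2 * 4) ≤ κ / 2) (hrate : r₁ + 2 * (64 * Real.log 162) + 2 ≤ R)
    (hsmall : A * Real.exp (5 * r₁ + 1) * K₀ 64 8 * 9 * 64 ≤ 1) (hδ₀ : 0 < δ₀) (hB₃ : 0 ≤ B₃) (hr : 0 < r)
    (h238 : ∀ K k, ((S K) k).Bound238 (Wk K k) (sp K k) A R)
    (Ec : ℕ → ℕ → Type*) [∀ K k, NormedAddCommGroup (Ec K k)] [∀ K k, NormedSpace ℂ (Ec K k)]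
    (ι : letI := θ.instVβ₁; letI := θ.instVβ₂
      (K k : ℕ) → (domSys (F.P K) M (k + 1)).Dom → ((Fin (F.P K).d → Site (F.P K) (k + 1) → θ.Vβ) →L[ℝ] Ec K k))
    (Φ : (K k : ℕ) → (domSys (F.P K) M (k + 1)).Dom → Ec K k → CPair (F.P K) (MatA N))
    (U : (K k : ℕ) → (domSys (F.P K) M (k + 1)).Dom → Set (Ec K k)) (hU : ∀ K k X, IsOpen (U K k X)) (hrU : ∀ K k X, ball (0 : Ec K k) r ⊆ U K k X)
    (hHhol : ∀ g ∈ Window θ.γ, ∀ (K k : ℕ) (X Z : (domSys (F.P K) M (k + 1)).Dom), Z.1 ⊆ X.1 →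
      DifferentiableOn ℂ (fun z => ((S K) k).H (histPrefix g k) (Φ K k X z) Z) (U K k X))
    (hΦemb : letI := θ.instVβ₁; letI := θ.instVβ₂
      ∀ (K k : ℕ) (X : (domSys (F.P K) M (k + 1)).Dom) (B : Fin (F.P K).d → Site (F.P K) (k + 1) → θ.Vβ),
        Φ K k X (ι K k X B) = emb K k (fun l t => NormedSpace.exp (θ.ρ8 (B l t))))
    (hΦsp : ∀ (K k : ℕ) (X : (domSys (F.P K) M (k + 1)).Dom), ∀ z ∈ U K k X, ∀ Z : (domSys (F.P K) M (k + 1)).Dom, Z.1 ⊆ X.1 → Φ K k X z ∈ sp K k Z)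
    (w : (K k : ℕ) → (domSys (F.P K) M (k + 1)).Dom → Site (F.P K) (k + 1) → ℝ) (hw₀ : ∀ K k X t, 0 ≤ w K k X t)
    (hw : letI := θ.instVβ₁; letI := θ.instVβ₂; letI := θ.instιβ
      ∀ (K k : ℕ) (X : (domSys (F.P K) M (k + 1)).Dom) (l : Fin (F.P K).d) (t : Site (F.P K) (k + 1)) (c : θ.ιβ),
        ‖ι K k X (Pi.single l (Pi.single t (θ.bV c)))‖ ≤ w K k X t)
    (htail : ∀ (K k : ℕ) (X : (domSys (F.P K) M (k + 1)).Dom) (t : Site (F.P K) (k + 1)),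
      let e : Site (F.P K) (k + 1) → TPt 4 (domCount (F.P K) M (k + 1) * M) := fun x i => (ZMod.cast (x i) : ZMod (domCount (F.P K) M (k + 1) * M))
      w K k X t ≤ B₃ * Real.exp (-δ₀ * distCT (domCount (F.P K) M (k + 1)) M (e t) (nearT (M := M) (e t) X)))
    (hκ' : κ' ≤ delta1 δ₀ κ ((M : ℝ) * 4)) (μ ν : Fin 4) :
    KernelDecayOfRecord₁₃ F N θ μ ν κ' := by
  have hd := windowedDecayOfRecord₁₃_of_activitySlots F N θ m' M hM S emb hloc Wk hWk sp hA hr₁ hκ hκ₀ hrate hsmall hδ₀ hB₃ hr h238 Ec ι Φ U hU hrU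
    hHhol hΦemb hΦsp w hw₀ hw htail μ ν
  have hd' : WindowedDecayOfRecord₁₃ F N θ μ ν κ' := by
    letI := θ.instVβ₁; letI := θ.instVβ₂; letI := θ.instιβ
    exact windowedDecay_of_le F _ θ.ρ8 θ.bV hd hκ'
  exact kernelDecayOfRecord₁₃_of_windowed F N θ μ ν _ ((polLimitsExistOfRecord₁₃_iff F N θ).1 hlim) ((windowedDecayOfRecord₁₃_iff F N θ μ ν _).1 hd')

/-! ## §3 The PIN FACE in activity currency: K3⁷ v5's N22 conjunct `N22At (rrOfRecord 𝔯 ksel F θ hP g₀ os).u3` at a reading pinned to the kernel objects of record -/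

open Classical in
/-- ★★★ **THE N22 CONJUNCT OF `KeyedRatesHolderD4` AT A PINNED READING, EVERY RUN LENGTH, FROM ACTIVITY-LEVEL SLOTS + (1.21) EXISTENCE.**  For a Stage-13 rate reading `𝔯`
whose node-U3 objects at the tuple `(F, θ, hP, g₀, os)` ARE the kernel objects of record (`hpin`, the `U3PinnedKernels` conjunct of K3⁷ v5's `GuardedReading` read at the
tuple), a letter block `ℓ` with its signs DOMINATING the engine's constants (`ℓ.κ ≤ δ₁`, `C_9·Λ ≤ ℓ.moduli`): towers∕reading with `Localizes17OfRecord₁₃`, W1's two activity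
slots (young-Lipschitz moduli `Λ (k+1) ·`), the complexified readings with holomorphic activities and exponentially localized site weights, Road 1's numerals and
`PolLimitsExistOfRecord₁₃` give `N22At (rateCarriersOfRecord₁₃CoPH 𝔯 F θ hP g₀ os k).u3` for EVERY `k` — §2's `h9` fed to dag-n22-w3's `n22At_rateCarriers_of_kernels_pin_of_ne9`
(= K3⁷ v5 §2b `n22At_rrOfRecord_of_pinned` at the selector's value).  LOCATED (hypothesis form); N22 NOT discharged. -/
theorem n22At_rateCarriers_of_kernels_pin_of_activitySlots (𝔯 : RateReading₁₃CoPH N) (θ : Stage13HParams F N) (hP : θ.Provisos₁₃CoPH F N)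
    (g₀ : ℕ → ℝ) (os : List (ULoop F)) (ℓ : U3Letters₁₁) (hs : ℓ.Signs) (hpin : (𝔯.lit F θ hP g₀ os).u3 = objectsOfRecord₁₃ F N θ.toStage13Params ℓ)
    (hlim : PolLimitsExistOfRecord₁₃ F N θ.toStage13Params) (m' : ℕ) (M : ℕ) [NeZero M] (hM : M = F.L ^ m')
    (S : (K : ℕ) → ClusterTower (F.P K) (MatA N) M) (emb : ReadingMaps F (MatA N) (MatA N)) (hloc : Localizes17OfRecord₁₃ F N θ.toStage13Params S emb)
    (Wk : (K k : ℕ) → Set (Fin (k + 1) → ℝ)) (hWk : ∀ g ∈ Window θ.γ, ∀ K k, histPrefix g k ∈ Wk K k)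
    (sp : (K k : ℕ) → (domSys (F.P K) M (k + 1)).Dom → Set (CPair (F.P K) (MatA N)))
    {A R r₁ κ δ₀ B₃ r : ℝ} (Λ : ℕ → ℕ → ℝ)
    (hA : 0 < A) (hr₁ : 0 ≤ r₁) (hκ : κ ≤ r₁) (hκ₀ : kappa₀ (4 * 2 ^ 4) (2 * 4) ≤ κ / 2) (hrate : r₁ + 2 * (64 * Real.log 162) + 2 ≤ R)
    (hsmall : 2 * A * Real.exp (5 * r₁ + 1) * K₀ 64 8 * 9 * 64 ≤ 1) (hΛ : ∀ k i, 0 ≤ Λ k i) (hδ₀ : 0 < δ₀) (hB₃ : 0 ≤ B₃) (hr : 0 < r)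
    (h238 : ∀ K k, ((S K) k).Bound238 (Wk K k) (sp K k) A R)
    (hYL : ∀ K k, ((S K) k).YoungLipschitz (Wk K k) (sp K k) (fun i : Fin (k + 1) => Λ (k + 1) i) R)
    (Ec : ℕ → ℕ → Type*) [∀ K k, NormedAddCommGroup (Ec K k)] [∀ K k, NormedSpace ℂ (Ec K k)]
    (ι : letI := θ.instVβ₁; letI := θ.instVβ₂
      (K k : ℕ) → (domSys (F.P K) M (k + 1)).Dom → ((Fin (F.P K).d → Site (F.P K) (k + 1) → θ.Vβ) →L[ℝ] Ec K k))
    (Φ : (K k : ℕ) → (domSys (F.P K) M (k + 1)).Dom → Ec K k → CPair (F.P K) (MatA N))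
    (U : (K k : ℕ) → (domSys (F.P K) M (k + 1)).Dom → Set (Ec K k)) (hU : ∀ K k X, IsOpen (U K k X)) (hrU : ∀ K k X, ball (0 : Ec K k) r ⊆ U K k X)
    (hHhol : ∀ g ∈ Window θ.γ, ∀ (K k : ℕ) (X Z : (domSys (F.P K) M (k + 1)).Dom), Z.1 ⊆ X.1 →
      DifferentiableOn ℂ (fun z => ((S K) k).H (histPrefix g k) (Φ K k X z) Z) (U K k X))
    (hΦemb : letI := θ.instVβ₁; letI := θ.instVβ₂
      ∀ (K k : ℕ) (X : (domSys (F.P K) M (k + 1)).Dom) (B : Fin (F.P K).d → Site (F.P K) (k + 1) → θ.Vβ),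
        Φ K k X (ι K k X B) = emb K k (fun l t => NormedSpace.exp (θ.ρ8 (B l t))))
    (hΦsp : ∀ (K k : ℕ) (X : (domSys (F.P K) M (k + 1)).Dom), ∀ z ∈ U K k X, ∀ Z : (domSys (F.P K) M (k + 1)).Dom, Z.1 ⊆ X.1 → Φ K k X z ∈ sp K k Z)
    (w : (K k : ℕ) → (domSys (F.P K) M (k + 1)).Dom → Site (F.P K) (k + 1) → ℝ) (hw₀ : ∀ K k X t, 0 ≤ w K k X t)
    (hw : letI := θ.instVβ₁; letI := θ.instVβ₂; letI := θ.instιβ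
      ∀ (K k : ℕ) (X : (domSys (F.P K) M (k + 1)).Dom) (l : Fin (F.P K).d) (t : Site (F.P K) (k + 1)) (c : θ.ιβ),
        ‖ι K k X (Pi.single l (Pi.single t (θ.bV c)))‖ ≤ w K k X t)
    (htail : ∀ (K k : ℕ) (X : (domSys (F.P K) M (k + 1)).Dom) (t : Site (F.P K) (k + 1)),
      let e : Site (F.P K) (k + 1) → TPt 4 (domCount (F.P K) M (k + 1) * M) := fun x i => (ZMod.cast (x i) : ZMod (domCount (F.P K) M (k + 1) * M))
      w K k X t ≤ B₃ * Real.exp (-δ₀ * distCT (domCount (F.P K) M (k + 1)) M (e t) (nearT (M := M) (e t) X)))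
    (hℓκ : ℓ.κ ≤ delta1 δ₀ κ ((M : ℝ) * 4))
    (hdom : ∀ k i, (16 * (8 * (Real.exp 1 * 9 * 64 * K₀ 64 8 ^ 2)) * B₃ ^ 2 / r ^ 2) *
        Real.exp (delta1 δ₀ κ ((M : ℝ) * 4) * ((M : ℝ) * 4) * 3) * K₀ (4 * 2 ^ 4) (2 * 4) * K₁ 4 (δ₀ / 2) * Λ k i ≤ ℓ.moduli k i) (k : ℕ) :
    N22At (rateCarriersOfRecord₁₃CoPH 𝔯 F θ hP g₀ os k).u3 :=
  n22At_rateCarriers_of_kernels_pin_of_ne9 𝔯 θ hP g₀ os ℓ hs hpin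
    (ne9_EA_objectsOfRecord₁₃_of_activitySlots F N θ.toStage13Params ℓ hs hlim m' M hM S emb hloc Wk hWk sp Λ hA hr₁ hκ hκ₀ hrate hsmall hΛ hδ₀ hB₃ hr
      h238 hYL Ec ι Φ U hU hrU hHhol hΦemb hΦsp w hw₀ hw htail hℓκ hdom) k

end YMDAG.N22.WindowSoftTwoPoint

end
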